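import Summits.QuantumFields.YangMills.Theorems.FiniteRankMirrorAssemblyCore
import Summits.QuantumFields.YangMills.Theorems.BalabanLadderNTConjugateResponse
import Summits.QuantumFields.YangMills.Theorems.BalabanLadderNTMarkovMirrorChiral
import Summits.QuantumFields.YangMills.Theorems.LangevinControlUVOSLegsFromFemtoAndGapStubCollar
import Summits.QuantumFields.YangMills.Theorems.LangevinControlUVOSLegsFromFemtoAndGapStubAssemblyPlaneStrings
import HarnessLib

/-!
# Route `FiniteRankMirror`, item `Assembly` (stmt-QuantumFields-25641): the multiplexed bare mirror floor

Helper file (`--supports stmt-QuantumFields-25641`), third of the series (`…Kernel`, `…Core`).  Here the abstract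
estimate `core_estimate` is run on the TORUS MIRROR KERNEL
`K_{β,L}(x,y) = E_T[dens_x∘Θ₀ · dens_y] − E_T dens_x · E_T dens_y`:

* §1 analytic odds and ends: the time floor and the Lipschitz constant of a compactly supported positive-time Schwartz mode, the cross budget `J²C5⁸/(D−2)⁸ ≤ κℓ^p/4` for the mesh
  `D = 3 + (4(J²+1)C5⁸/κ)^(1/8)·ℓ^(−p/8)`;
* §2 the torus mirror form of a smeared density IS the double sum of its coefficients against `K_{β,L}`
  (bilinearity of `torusE`, tree `MarkovMirror.torusCov_sum_sum`; `Θ₀`-invariance `ConjugateResponse.torusE_comp_cfgReflect`),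
  and `K_{β,L}` is invariant under SPATIAL lattice translations (tree `torusE_comp_configShift`,
  `cfgReflect_configShift`);
* §3 `multiplex_floor`: from the finite-rank floor body of `FiniteRankMirrorFloor` and the pointwise ceiling of
  `MirrorCrossDecay`, for every radius `T > 0` ONE positive-time real Schwartz `V ⊆ B(0,T)` with
  `E_T[(Ṽ∘Θ₀)·Ṽ] − E_T[Ṽ]² ≥ κℓ^p/2 > 0` on all large tori at all large `β`.

Refs: Fröhlich–Israel–Lieb–Simon 1978 (RP Gram form); Osterwalder–Seiler 1978 §2 (site reflection, translations);
planner plan `assembly_plan_25641.md`.  R3/RECORD framing: bookkeeping over the route's hypotheses; nothing here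
proves a floor, a ceiling, NT or the Yang–Mills mass gap.
-/

set_option autoImplicit false

noncomputable section

open scoped SchwartzMap
open MeasureTheory Filter Topology
open Literature.MathematicalPhysics.QuantumFieldTheory Literature.MathematicalPhysics.QuantumLattice
open Literature.Probability.LatticeModels
open Summit.QuantumFields.YangMills.Cruxes.OSLegsFromFemtoAndGap.DlrCollarTransfer

namespace Summit.QuantumFields.YangMills.Theorems.FiniteRankMirror

/-! ## §1 Analytic odds and ends: time floor and Lipschitz constant of a mode, cross budget -/

section Odds

/-- **Time floor of a positive-time mode.**  A real Schwartz function whose topological support is contained in the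
open half-space `{z₀ > 0}` and in a closed ball vanishes below some positive height `δ`. [folklore] -/
theorem exists_time_floor (v : 𝓢(EuclideanSpace ℝ (Fin 4), ℝ)) {ℓ : ℝ}
    (hvp : tsupport (v : EuclideanSpace ℝ (Fin 4) → ℝ) ⊆ {y | 0 < y 0})
    (hvb : tsupport (v : EuclideanSpace ℝ (Fin 4) → ℝ) ⊆ Metric.closedBall 0 ℓ) :
    ∃ δ : ℝ, 0 < δ ∧ ∀ z, v z ≠ 0 → δ ≤ z 0 := by
  have hK : IsCompact (tsupport (v : EuclideanSpace ℝ (Fin 4) → ℝ)) :=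
    IsCompact.of_isClosed_subset (isCompact_closedBall 0 ℓ) (isClosed_tsupport _) hvb
  by_cases hne : (tsupport (v : EuclideanSpace ℝ (Fin 4) → ℝ)).Nonempty
  · have hc : Continuous fun z : EuclideanSpace ℝ (Fin 4) => z 0 := by fun_prop
    obtain ⟨z₀, hz₀, hmin⟩ := hK.exists_isMinOn hne hc.continuousOn
    exact ⟨z₀ 0, hvp hz₀, fun z hz => (isMinOn_iff.mp hmin) z (subset_tsupport _ hz)⟩
  · exact ⟨1, one_pos, fun z hz => absurd ⟨z, subset_tsupport _ hz⟩ hne⟩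

/-- **Lipschitz constant of a compactly supported Schwartz function.** [folklore] -/
theorem exists_lipschitz_bound (v : 𝓢(EuclideanSpace ℝ (Fin 4), ℝ)) {ℓ : ℝ}
    (hvb : tsupport (v : EuclideanSpace ℝ (Fin 4) → ℝ) ⊆ Metric.closedBall 0 ℓ) :
    ∃ M : ℝ, 0 ≤ M ∧ ∀ z z', |v z - v z'| ≤ M * ‖z - z'‖ := by
  have hK : HasCompactSupport (v : EuclideanSpace ℝ (Fin 4) → ℝ) :=
    IsCompact.of_isClosed_subset (isCompact_closedBall 0 ℓ) (isClosed_tsupport _) hvb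
  obtain ⟨C, hC⟩ := ContDiff.lipschitzWith_of_hasCompactSupport hK (v.smooth 1) (by simp)
  refine ⟨C, C.2, fun z z' => ?_⟩
  have := hC.dist_le_mul z z'
  rwa [Real.dist_eq, dist_eq_norm] at this

/-- The choice of the grid mesh: with `A = (4(J²+1)C·5⁸/κ)^(1/8)` and `D = 3 + A·ℓ^(−p/8)` the total cross budget is
`J²·C·5⁸/(D−2)⁸ ≤ κℓ^p/4`. [folklore] -/
theorem cross_budget (J : ℕ) {p κ C ℓ : ℝ} (hκ : 0 < κ) (hC : 0 < C) (hℓ : 0 < ℓ) :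
    (J : ℝ) ^ 2 * (C * 5 ^ 8 /
        (3 + (4 * ((J : ℝ) ^ 2 + 1) * C * 5 ^ 8 / κ) ^ (1 / 8 : ℝ) * ℓ ^ (-(p / 8)) - 2) ^ 8) ≤
      κ * ℓ ^ p / 4 := by
  set B : ℝ := 4 * ((J : ℝ) ^ 2 + 1) * C * 5 ^ 8 / κ with hB
  have hB0 : 0 < B := by positivity
  set A : ℝ := B ^ (1 / 8 : ℝ) with hA
  have hA0 : 0 ≤ A := Real.rpow_nonneg hB0.le _
  have hA8 : A ^ 8 = B := by
    rw [hA, ← Real.rpow_natCast, ← Real.rpow_mul hB0.le]; norm_num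
  have hℓp : 0 < ℓ ^ p := Real.rpow_pos_of_pos hℓ p
  have hx0 : 0 ≤ A * ℓ ^ (-(p / 8)) := mul_nonneg hA0 (Real.rpow_nonneg hℓ.le _)
  have h1 : A * ℓ ^ (-(p / 8)) ≤ 3 + A * ℓ ^ (-(p / 8)) - 2 := by linarith
  have h2 : (A * ℓ ^ (-(p / 8))) ^ 8 ≤ (3 + A * ℓ ^ (-(p / 8)) - 2) ^ 8 := pow_le_pow_left₀ hx0 h1 8
  have h3 : (A * ℓ ^ (-(p / 8))) ^ 8 = B * (ℓ ^ p)⁻¹ := by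
    rw [mul_pow, hA8, ← Real.rpow_natCast (ℓ ^ (-(p / 8))) 8, ← Real.rpow_mul hℓ.le]
    rw [show (-(p / 8) * ((8 : ℕ) : ℝ) : ℝ) = -p by push_cast; ring, Real.rpow_neg hℓ.le]
  have hD2 : 0 < (3 + A * ℓ ^ (-(p / 8)) - 2) ^ 8 := pow_pos (by linarith) 8
  have h4 : B ≤ (3 + A * ℓ ^ (-(p / 8)) - 2) ^ 8 * ℓ ^ p := by
    have := mul_le_mul_of_nonneg_right (h3 ▸ h2) hℓp.le
    rwa [mul_assoc, inv_mul_cancel₀ hℓp.ne', mul_one] at this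
  have h5 : C * 5 ^ 8 / (3 + A * ℓ ^ (-(p / 8)) - 2) ^ 8 ≤ κ * ℓ ^ p / (4 * ((J : ℝ) ^ 2 + 1)) := by
    rw [div_le_div_iff₀ hD2 (by positivity)]
    have e : C * 5 ^ 8 * (4 * ((J : ℝ) ^ 2 + 1)) = B * κ := by rw [hB]; field_simp
    rw [e]
    nlinarith
  calc (J : ℝ) ^ 2 * (C * 5 ^ 8 / (3 + A * ℓ ^ (-(p / 8)) - 2) ^ 8)
      ≤ (J : ℝ) ^ 2 * (κ * ℓ ^ p / (4 * ((J : ℝ) ^ 2 + 1))) := mul_le_mul_of_nonneg_left h5 (by positivity)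
    _ ≤ κ * ℓ ^ p / 4 := by
        rw [mul_div_assoc', div_le_div_iff₀ (by positivity) (by positivity)]
        nlinarith [mul_pos hκ hℓp]

end Odds

/-! ## §2 The torus mirror form as a double sum against the mirror kernel; spatial translation invariance -/

section Torus

variable (G : Type) [Group G] [TopologicalSpace G] [IsTopologicalGroup G] [CompactSpace G]
  [MeasurableSpace G] [BorelSpace G] (r : LatticeRep G)

/-- **The mirror form of a smeared density is the double sum of its coefficients against the mirror kernel**:
`E_T[(Σ c_y dens_y)∘Θ₀ · Σ c_y dens_y] − E_T[Σ c_y dens_y]² = Σ_x Σ_y c_x c_y (E_T[dens_x∘Θ₀ · dens_y] − E_T dens_x · E_T dens_y)`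
(bilinearity of the torus expectation over continuous observables, tree `MarkovMirror.torusCov_sum_sum`, and
`Θ₀`-invariance of `E_T`, tree `ConjugateResponse.torusE_comp_cfgReflect`). [folklore] -/
theorem mirrorForm_eq_sum_sum (β : ℝ) (L : ℕ) (c : (Fin 4 → ℤ) → ℝ) :
    torusE G r β L (fun V => (∑ y ∈ box 4 L, c y * dens G r y (cfgReflect V)) *
        ∑ y ∈ box 4 L, c y * dens G r y V) -
      torusE G r β L (fun V => ∑ y ∈ box 4 L, c y * dens G r y V) ^ 2 =
    ∑ x ∈ box 4 L, ∑ y ∈ box 4 L, c x * c y *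
      (torusE G r β L (fun V => dens G r x (cfgReflect V) * dens G r y V) -
        torusE G r β L (dens G r x) * torusE G r β L (dens G r y)) := by
  have hF : ∀ x ∈ box 4 L, Continuous fun V : LGConfig 4 G => dens G r x (cfgReflect V) := fun x _ =>
    (continuous_dens r x).comp Cruxes.NT.MarkovMirror.continuous_cfgReflect
  have hH : ∀ y ∈ box 4 L, Continuous fun V : LGConfig 4 G => dens G r y V := fun y _ => continuous_dens r y
  have h := Cruxes.NT.MarkovMirror.torusCov_sum_sum G r β L (box 4 L) (box 4 L) c c
    (fun x V => dens G r x (cfgReflect V)) (fun y V => dens G r y V) hF hH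
  have e1 : torusE G r β L (fun V => ∑ x ∈ box 4 L, c x * dens G r x (cfgReflect V)) =
      torusE G r β L (fun V => ∑ y ∈ box 4 L, c y * dens G r y V) :=
    Cruxes.NT.ConjugateResponse.torusE_comp_cfgReflect G r β L (fun V => ∑ y ∈ box 4 L, c y * dens G r y V)
  have e2 : ∀ x, torusE G r β L (fun V => dens G r x (cfgReflect V)) = torusE G r β L (dens G r x) := fun x =>
    Cruxes.NT.ConjugateResponse.torusE_comp_cfgReflect G r β L (dens G r x)
  rw [e1] at h
  simp only [e2] at h
  rw [sq]
  exact h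

/-- Translating the site translates the action density: `dens_{x+n} = dens_x ∘ τ₋ₙ` (`τ_v = configShift v`).
[folklore] -/
theorem dens_add_eq (x n : Fin 4 → ℤ) :
    dens G r (x + n) = dens G r x ∘ configShift (-n) := by
  funext U
  unfold dens
  simp only [Function.comp_apply]
  congr 1
  funext e
  simp only [Literature.MathematicalPhysics.QuantumLattice.configShift_apply]
  congr 2
  ext i
  simp only [Pi.sub_apply, Pi.neg_apply, Pi.add_apply]
  ring

/-- The torus expectation is invariant under lattice translations of the observable (tree
`torusE_comp_configShift`: every translate has the same `wilsonTorusMean`). [folklore] -/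
theorem torusE_comp_configShift_neg (β : ℝ) (L : ℕ) (O : LGConfig 4 G → ℝ) (n : Fin 4 → ℤ) :
    torusE G r β L (O ∘ configShift (-n)) = torusE G r β L O := by
  have h1 := OSLegsFromFemtoAndGap.torusE_comp_configShift r β L O n
  have h0 := OSLegsFromFemtoAndGap.torusE_comp_configShift r β L O 0
  have e0 : O ∘ configShift (-(0 : Site 4)) = O := by
    funext V
    simp only [Function.comp_apply, neg_zero]
    congr 1
    funext e
    simp [Literature.MathematicalPhysics.QuantumLattice.configShift_apply]
  rw [e0] at h0
  rw [← h0] at h1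
  exact h1

/-- **Spatial translation invariance of the mirror kernel**: for a lattice vector `n` with `n₀ = 0`,
`K_{β,L}(x+n, y+n) = K_{β,L}(x, y)` — the reflection `Θ₀` commutes with spatial translations
(`cfgReflect_configShift`, `θ₀ n = n`) and `E_T` is translation invariant. [folklore] -/
theorem mirrorKer_add_spatial (β : ℝ) (L : ℕ) (x y n : Fin 4 → ℤ) (hn : n 0 = 0) :
    torusE G r β L (fun V => dens G r (x + n) (cfgReflect V) * dens G r (y + n) V) -
        torusE G r β L (dens G r (x + n)) * torusE G r β L (dens G r (y + n)) =
      torusE G r β L (fun V => dens G r x (cfgReflect V) * dens G r y V) -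
        torusE G r β L (dens G r x) * torusE G r β L (dens G r y) := by
  have hsr : siteReflect (-n) = -n := by
    unfold siteReflect
    rw [Function.update_eq_iff]
    refine ⟨?_, fun _ _ => rfl⟩
    simp [hn]
  have hcomm : ∀ V : LGConfig 4 G, cfgReflect (configShift (-n) V) = configShift (-n) (cfgReflect V) := by
    intro V
    rw [cfgReflect_configShift, hsr]
  have e1 : (fun V => dens G r (x + n) (cfgReflect V) * dens G r (y + n) V) =
      (fun W => dens G r x (cfgReflect W) * dens G r y W) ∘ configShift (-n) := by
    funext V
    simp only [dens_add_eq, Function.comp_apply, hcomm]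
  rw [e1, dens_add_eq G r x n, dens_add_eq G r y n, torusE_comp_configShift_neg, torusE_comp_configShift_neg,
    torusE_comp_configShift_neg]

end Torus


/-! ## §3 The multiplexed bare mirror floor -/

section Multiplex

variable (G : Type) [Group G] [TopologicalSpace G] [IsTopologicalGroup G] [CompactSpace G]
  [MeasurableSpace G] [BorelSpace G] (r : LatticeRep G)
set_option maxHeartbeats 400000 in
/-- **Multiplexed bare mirror floor at any femto radius.**  Given a unit `a → 0⁺`, the finite-rank floor body of
`FiniteRankMirrorFloor` for `(r, a)` (rank `J`, exponent `p < 8`, `κ > 0`, floors `κℓ^p ≤ Σ_j MF_β(v_j)` along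
arbitrarily small femto scales `ℓ`) and the pointwise mirror ceiling of `MirrorCrossDecay` in the window `ℓ₄`, for
every `T > 0` there is ONE positive-time real Schwartz `V` supported in `B(0,T)` with `MF_β(V) ≥ κℓ^p/2 > 0` on all
large tori at all large `β`, where `MF_β(V) = E_T[(Ṽ∘Θ₀)·Ṽ] − E_T[Ṽ]²`, `Ṽ = Σ_y V(a(β)·y)·dens_y`.  `V` is the
multiplexed function `Σ_j v_j(· − jDℓ·e₁)` with mesh `D = 3 + A·ℓ^(−p/8)`; the estimate is `core_estimate` for the
torus mirror kernel (kernel form `mirrorForm_eq_sum_sum`, spatial translation invariance `mirrorKer_add_spatial`),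
the cross budget `cross_budget` and the rounding budget `O(a(β)) → 0`. [folklore] -/
theorem multiplex_floor (a : ℝ → ℝ) (ha : ∀ β, 0 < a β) (ha0 : Tendsto a atTop (𝓝 0))
    {J : ℕ} {p κ : ℝ} (hp : p < 8) (hκ : 0 < κ)
    (hscale : ∀ ℓ₁ : ℝ, 0 < ℓ₁ → ∃ (ℓ : ℝ) (v : Fin J → 𝓢(EuclideanSpace ℝ (Fin 4), ℝ)) (β₅ Λ₅ : ℝ),
      0 < ℓ ∧ ℓ < ℓ₁ ∧ (∀ j, tsupport (v j : EuclideanSpace ℝ (Fin 4) → ℝ) ⊆ {y | 0 < y 0} ∧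
        tsupport (v j : EuclideanSpace ℝ (Fin 4) → ℝ) ⊆ Metric.closedBall 0 ℓ ∧ ∀ z, |v j z| ≤ 1) ∧
      ∀ β : ℝ, β₅ ≤ β → ∀ L : ℕ, Λ₅ ≤ a β * L → κ * ℓ ^ p ≤
        ∑ j, (torusE G r β L (fun U => (∑ y ∈ box 4 L, v j (a β • siteToE y) * dens G r y (cfgReflect U)) *
            ∑ y ∈ box 4 L, v j (a β • siteToE y) * dens G r y U) -
          torusE G r β L (fun U => ∑ y ∈ box 4 L, v j (a β • siteToE y) * dens G r y U) ^ 2))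
    {ℓ₄ C β₆ Λ₆ : ℝ} (hℓ₄ : 0 < ℓ₄)
    (hceil : ∀ β : ℝ, β₆ ≤ β → ∀ L : ℕ, Λ₆ ≤ a β * L → ∀ x y : Fin 4 → ℤ, 1 ≤ x 0 → 1 ≤ y 0 →
      ‖a β • siteToE x‖ ≤ ℓ₄ → ‖a β • siteToE y‖ ≤ ℓ₄ →
      |torusE G r β L (fun U => dens G r x (cfgReflect U) * dens G r y U) -
          torusE G r β L (dens G r x) * torusE G r β L (dens G r y)| ≤
        C / ‖siteToE (Function.update (x - y) 0 (x 0 + y 0))‖ ^ 8)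
    (T : ℝ) (hT : 0 < T) :
    ∃ (V : 𝓢(EuclideanSpace ℝ (Fin 4), ℝ)) (ε₀ β₀ Λ₀ : ℝ),
      tsupport (V : EuclideanSpace ℝ (Fin 4) → ℝ) ⊆ {y | 0 < y 0} ∧
      tsupport (V : EuclideanSpace ℝ (Fin 4) → ℝ) ⊆ Metric.closedBall 0 T ∧ 0 < ε₀ ∧
      ∀ β : ℝ, β₀ ≤ β → ∀ L : ℕ, Λ₀ ≤ a β * L → ε₀ ≤
        torusE G r β L (fun U => (∑ y ∈ box 4 L, V (a β • siteToE y) * dens G r y (cfgReflect U)) *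
            ∑ y ∈ box 4 L, V (a β • siteToE y) * dens G r y U) -
          torusE G r β L (fun U => ∑ y ∈ box 4 L, V (a β • siteToE y) * dens G r y U) ^ 2 := by
  classical
  -- constants
  set C' : ℝ := max C 1 with hC'
  have hC'0 : 0 < C' := lt_of_lt_of_le one_pos (le_max_right _ _)
  have hCC' : C ≤ C' := le_max_left _ _
  set T' : ℝ := min T ℓ₄ with hT'
  have hT'0 : 0 < T' := lt_min hT hℓ₄
  set A : ℝ := (4 * ((J : ℝ) ^ 2 + 1) * C' * 5 ^ 8 / κ) ^ (1 / 8 : ℝ) with hA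
  have hA0 : 0 ≤ A := Real.rpow_nonneg (by positivity) _
  obtain ⟨ℓ₁, hℓ₁, hroom⟩ := exists_room J hp (A := A) hT'0
  obtain ⟨ℓ, v, β₅, Λ₅, hℓ, hℓℓ₁, hv, hfloor⟩ := hscale ℓ₁ hℓ₁
  set D : ℝ := 3 + A * ℓ ^ (-(p / 8)) with hD
  have hAD : 0 ≤ A * ℓ ^ (-(p / 8)) := mul_nonneg hA0 (Real.rpow_nonneg hℓ.le _)
  have hD3 : 3 ≤ D := by rw [hD]; linarith
  have hD0 : 0 ≤ D := by linarith
  -- room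
  have hR : ((J : ℝ) * D + 2) * ℓ < T' := by
    have e : ((J : ℝ) * D + 2) * ℓ = (3 * J + 2) * ℓ + J * A * ℓ ^ (1 - p / 8) := by
      rw [hD, show (1 - p / 8 : ℝ) = 1 + -(p / 8) by ring, Real.rpow_add hℓ, Real.rpow_one]; ring
    have := hroom ℓ hℓ hℓℓ₁
    rw [e]
    nlinarith [hℓ.le]
  have hRT : ((J : ℝ) * D + 2) * ℓ ≤ T := hR.le.trans (min_le_left _ _)
  have hRℓ₄ : ((J : ℝ) * D + 2) * ℓ ≤ ℓ₄ := hR.le.trans (min_le_right _ _)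
  -- cross budget
  have hcross : (J : ℝ) ^ 2 * (C' * 5 ^ 8 / (D - 2) ^ 8) ≤ κ * ℓ ^ p / 4 := by
    have := cross_budget J (p := p) hκ hC'0 hℓ
    rw [hD, hA]
    exact this
  -- per-mode constants
  have hδj : ∀ j, ∃ δ : ℝ, 0 < δ ∧ ∀ z, v j z ≠ 0 → δ ≤ z 0 := fun j =>
    exists_time_floor (v j) (hv j).1 (hv j).2.1
  choose δj hδj0 hδj using hδj
  obtain ⟨δ, hδ, hδle⟩ : ∃ δ : ℝ, 0 < δ ∧ ∀ j, δ ≤ δj j := by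
    have hsum : 0 ≤ ∑ k, 1 / δj k := Finset.sum_nonneg fun k _ => (one_div_pos.mpr (hδj0 k)).le
    refine ⟨1 / (1 + ∑ j, 1 / δj j), one_div_pos.mpr (by linarith), fun j => ?_⟩
    have h1 : 1 / δj j ≤ 1 + ∑ k, 1 / δj k := by
      have := Finset.single_le_sum (f := fun k => 1 / δj k) (fun k _ => (one_div_pos.mpr (hδj0 k)).le)
        (Finset.mem_univ j)
      linarith
    calc 1 / (1 + ∑ k, 1 / δj k) ≤ 1 / (1 / δj j) := one_div_le_one_div_of_le (one_div_pos.mpr (hδj0 j)) h1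
      _ = δj j := one_div_one_div (δj j)
  have hMj : ∀ j, ∃ M : ℝ, 0 ≤ M ∧ ∀ z z', |v j z - v j z'| ≤ M * ‖z - z'‖ := fun j =>
    exists_lipschitz_bound (v j) (hv j).2.1
  choose Mj hMj0 hMj using hMj
  obtain ⟨M, hM, hMle⟩ : ∃ M : ℝ, 0 ≤ M ∧ ∀ j, Mj j ≤ M :=
    ⟨∑ j, |Mj j|, Finset.sum_nonneg fun j _ => abs_nonneg _, fun j => (le_abs_self _).trans
      (Finset.single_le_sum (f := fun k => |Mj k|) (fun k _ => abs_nonneg _) (Finset.mem_univ j))⟩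
  have hv0 : ∀ j z, v j z ≠ 0 → δ ≤ z 0 := fun j z hz => (hδle j).trans (hδj j z hz)
  have hvℓ : ∀ j z, v j z ≠ 0 → ‖z‖ ≤ ℓ := fun j z hz =>
    mem_closedBall_zero_iff.mp ((hv j).2.1 (subset_tsupport _ hz))
  have hv1 : ∀ j z, |v j z| ≤ 1 := fun j => (hv j).2.2
  have hvM : ∀ j z z', |v j z - v j z'| ≤ M * ‖z - z'‖ := fun j z z' =>
    (hMj j z z').trans (mul_le_mul_of_nonneg_right (hMle j) (norm_nonneg _))
  -- the multiplexed test function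
  set Vm : 𝓢(EuclideanSpace ℝ (Fin 4), ℝ) :=
    ∑ j : Fin J, translateTest (EuclideanSpace.single (1 : Fin 4) (((j : ℕ) : ℝ) * D * ℓ)) (v j) with hVm
  have hVapp : ∀ z, Vm z = ∑ j, v j (z - EuclideanSpace.single 1 (((j : ℕ) : ℝ) * D * ℓ)) := by
    intro z
    rw [hVm, sum_apply]
    simp only [translateTest_apply]
  have hF : tsupport (Vm : EuclideanSpace ℝ (Fin 4) → ℝ) ⊆
      ⋃ j : Fin J, (fun z => z - EuclideanSpace.single (1 : Fin 4) (((j : ℕ) : ℝ) * D * ℓ)) ⁻¹'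
        tsupport (v j : EuclideanSpace ℝ (Fin 4) → ℝ) := by
    refine closure_minimal ?_ (isClosed_iUnion_of_finite fun j => (isClosed_tsupport _).preimage (by fun_prop))
    intro z hz
    rw [Function.mem_support, hVapp] at hz
    obtain ⟨j, -, hj⟩ := Finset.exists_ne_zero_of_sum_ne_zero hz
    exact Set.mem_iUnion.2 ⟨j, subset_tsupport _ hj⟩
  have hVpos : tsupport (Vm : EuclideanSpace ℝ (Fin 4) → ℝ) ⊆ {y | 0 < y 0} := by
    intro z hz
    obtain ⟨j, hj⟩ := Set.mem_iUnion.1 (hF hz)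
    have := (hv j).1 hj
    simpa using this
  have hVball : tsupport (Vm : EuclideanSpace ℝ (Fin 4) → ℝ) ⊆ Metric.closedBall 0 T := by
    intro z hz
    obtain ⟨j, hj⟩ := Set.mem_iUnion.1 (hF hz)
    have h1 := mem_closedBall_zero_iff.mp ((hv j).2.1 hj)
    rw [mem_closedBall_zero_iff]
    have h2 : ‖(EuclideanSpace.single (1 : Fin 4) (((j : ℕ) : ℝ) * D * ℓ) : EuclideanSpace ℝ (Fin 4))‖ =
        ((j : ℕ) : ℝ) * D * ℓ := by
      rw [PiLp.norm_single, Real.norm_eq_abs, abs_of_nonneg (by positivity)]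
    have h3 : ((j : ℕ) : ℝ) * D * ℓ + ℓ ≤ ((J : ℝ) * D + 2) * ℓ := by
      have hj : ((j : ℕ) : ℝ) + 1 ≤ J := by exact_mod_cast j.isLt
      nlinarith [mul_nonneg hD0 hℓ.le, hℓ.le]
    have := norm_sub_norm_le z (EuclideanSpace.single (1 : Fin 4) (((j : ℕ) : ℝ) * D * ℓ))
    linarith
  -- thresholds
  set B₁ : ℝ := 2 * M * C' * (2 * ℓ + 3) ^ 8 / (2 * δ) ^ 8 with hB₁
  have hB₁0 : 0 ≤ B₁ := by positivity
  set η : ℝ := κ * ℓ ^ p / (4 * ((J : ℝ) * B₁ + 1)) with hη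
  have hℓp : 0 < ℓ ^ p := Real.rpow_pos_of_pos hℓ p
  have hη0 : 0 < η := by positivity
  have hm0 : 0 < min (min ℓ 1) η := lt_min (lt_min hℓ one_pos) hη0
  obtain ⟨βa, hβa⟩ : ∃ βa : ℝ, ∀ β, βa ≤ β → a β ≤ min (min ℓ 1) η :=
    Filter.eventually_atTop.mp (ha0.eventually (eventually_le_nhds hm0))
  refine ⟨Vm, κ * ℓ ^ p / 2, max (max β₅ β₆) βa, max (max Λ₅ Λ₆) (((J : ℝ) * D + 2) * ℓ), hVpos, hVball,
    by positivity, ?_⟩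
  intro β hβ L hL
  simp only [max_le_iff] at hβ hL
  obtain ⟨⟨hβ5, hβ6⟩, hβa'⟩ := hβ
  obtain ⟨⟨hL5, hL6⟩, hLR⟩ := hL
  have hs := ha β
  have hsmin := hβa β hβa'
  have hsℓ : a β ≤ ℓ := hsmin.trans ((min_le_left _ _).trans (min_le_left _ _))
  have hs1 : a β ≤ 1 := hsmin.trans ((min_le_left _ _).trans (min_le_right _ _))
  have hsη : a β ≤ η := hsmin.trans (min_le_right _ _)
  -- the kernel at (β, L)
  obtain ⟨K, hK⟩ : ∃ K : (Fin 4 → ℤ) → (Fin 4 → ℤ) → ℝ, ∀ x y, K x y =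
      torusE G r β L (fun U => dens G r x (cfgReflect U) * dens G r y U) -
        torusE G r β L (dens G r x) * torusE G r β L (dens G r y) := ⟨_, fun _ _ => rfl⟩
  have hKtr : ∀ x y n : Fin 4 → ℤ, n 0 = 0 → K (x + n) (y + n) = K x y := fun x y n hn => by
    rw [hK, hK]; exact mirrorKer_add_spatial G r β L x y n hn
  have hKbd : ∀ x y : Fin 4 → ℤ, 1 ≤ x 0 → 1 ≤ y 0 → ‖a β • siteToE x‖ ≤ ((J : ℝ) * D + 2) * ℓ →
      ‖a β • siteToE y‖ ≤ ((J : ℝ) * D + 2) * ℓ →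
      |K x y| ≤ C' / ‖siteToE (Function.update (x - y) 0 (x 0 + y 0))‖ ^ 8 := by
    intro x y hx hy hxR hyR
    rw [hK]
    exact (hceil β hβ6 L hL6 x y hx hy (hxR.trans hRℓ₄) (hyR.trans hRℓ₄)).trans
      (div_le_div_of_nonneg_right hCC' (by positivity))
  have core := core_estimate L v K hs hsℓ hs1 hδ hM hC'0.le hD3 hv0 hvℓ hv1 hvM hLR hKtr hKbd
  -- identify the mirror forms with the kernel double sums
  have eV := mirrorForm_eq_sum_sum G r β L (fun y => Vm (a β • siteToE y))
  have ej : ∀ j, torusE G r β L (fun U => (∑ y ∈ box 4 L, v j (a β • siteToE y) * dens G r y (cfgReflect U)) *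
        ∑ y ∈ box 4 L, v j (a β • siteToE y) * dens G r y U) -
      torusE G r β L (fun U => ∑ y ∈ box 4 L, v j (a β • siteToE y) * dens G r y U) ^ 2 =
      ∑ x ∈ box 4 L, ∑ y ∈ box 4 L, v j (a β • siteToE x) * v j (a β • siteToE y) * K x y := by
    intro j
    rw [mirrorForm_eq_sum_sum G r β L (fun y => v j (a β • siteToE y))]
    simp only [hK]
  have hfl := hfloor β hβ5 L hL5
  simp only [ej] at hfl
  simp only [hVapp, ← hK] at eV
  -- rounding budget
  have hround : (J : ℝ) * B₁ * a β ≤ κ * ℓ ^ p / 4 := by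
    have h1 : (J : ℝ) * B₁ * a β ≤ (J : ℝ) * B₁ * η := mul_le_mul_of_nonneg_left hsη (by positivity)
    have h2 : (J : ℝ) * B₁ * η ≤ κ * ℓ ^ p / 4 := by
      rw [hη, mul_div_assoc', div_le_div_iff₀ (by positivity) (by positivity)]
      nlinarith [mul_pos hκ hℓp, hB₁0]
    linarith
  -- conclude
  have hgoal : κ * ℓ ^ p / 2 ≤ ∑ x ∈ box 4 L, ∑ y ∈ box 4 L,
      (∑ j, v j (a β • siteToE x - EuclideanSpace.single 1 (((j : ℕ) : ℝ) * D * ℓ))) *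
        (∑ j, v j (a β • siteToE y - EuclideanSpace.single 1 (((j : ℕ) : ℝ) * D * ℓ))) * K x y := by
    have e1 : (J : ℝ) * (2 * M * C' * (2 * ℓ + 3) ^ 8 / (2 * δ) ^ 8) * a β = (J : ℝ) * B₁ * a β := by rw [hB₁]
    rw [e1] at core
    linarith
  simp only [hVapp]
  rw [eV]
  exact hgoal

end Multiplex

end Summit.QuantumFields.YangMills.Theorems.FiniteRankMirror

end
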